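import Summits.CriticalPhenomena.PercolationContinuityZ3.Theorems.PercNearOneGluingNoHeavyLowerTailSahiOneStepProfileGridChainRule
import HarnessLib

/-!
# The OR-CYLINDER STEP for `(2′)` on a product of `PF₂` chains — preliminaries

Prover prim-ineq-prove-3 gen 45 (`--supports stmt-CriticalPhenomena-4575`; memo
`run/shared/lean/prim/prim-ineq-prove-3/PROOF-G45-CHAIN-RULE.md` §5–6).  Companion of `…ProfileGridChainRule` (the AND-step).

THE OR-STEP (memo §5, paper proof, every step verified exactly).  On a grid `X × G'` (`X` the cut coordinate `i`, weights `φ_i`;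
`G'` the other `PF₂` chains), `U = {v_i ≥ c}`, `C` an up-set not depending on `v_i`, `B = U ∪ C`: splitting the weight into the pieces
`v_i ≥ c` (atoms `Z₁, L₁, P₁, Q₁`) and `v_i < c` (atoms `Z₀, L₀, G₀, T₀, A₀, S₀, R₀`) gives the FORMAL polynomial identity
`Z₀·K̃(u;B) = (Z₀+Z₁)·K̃₀ + Z₀·M̃₁ + M̃₂'` (`orStep_identity`), `K̃₀ = K̃` of the low piece against `C`; hence
`K̃₀, M̃₁, M̃₂' ≥ 0 ⟹ K̃(u;B) ≥ 0` (`orStep_arith`).  The two mixed forms are signed (next file) fibre by fibre along `v_i`, using the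
class hypothesis for `C` on the fibre grid at a shifted slot, ball monotonicity (Efron) and the weighted Chebyshev sum inequality
(`weighted_chebyshev_antivary`).  This file also provides the fibre bookkeeping along one coordinate: `fibre_sum_decomp`,
the cross-fibre identity for `i`-invariant integrands (`fibre_cross_eq`) and the cross-fibre inequality for a numerator with the
one-coordinate cross inequalities (`fibre_cross_le`).  No definitions, no sorries.
-/

noncomputable section

namespace Summit.CriticalPhenomena.PercolationContinuityZ3.Theorems

namespace SahiOneStep

namespace ProfileGrid

open Finset Function
open Literature.Probability.Distributions (IsLogConcaveSeq piWeight blockSum)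
open scoped Classical

variable {κ : Type*} [Fintype κ] [DecidableEq κ] {N : ℕ}

/-! ## The two-piece identity and its arithmetic consequence -/

/-- **TWO-PIECE IDENTITY for `B = U ∪ C`** (formal polynomial identity in the eleven atoms; memo §5.1 in homogeneous form).
High piece (`v_i ≥ c`, where `B` is everything): `Z₁ = w`, `L₁ = w(L)`, `P₁ = u(H)`, `Q₁ = u(L)`.  Low piece (`v_i < c`, where `B = C`):
`Z₀ = w`, `L₀ = w(L)`, `G₀ = w(C)`, `T₀ = w(C∩L)`, `A₀ = u`, `S₀ = u(L)`, `R₀ = u(C∩H)`. [this work] -/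
theorem orStep_identity (Z₁ L₁ P₁ Q₁ Z₀ L₀ G₀ T₀ A₀ S₀ R₀ : ℝ) :
    Z₀ * ((Z₁ + Z₀) * (L₁ + L₀) * (P₁ + R₀) + (Z₁ + Z₀) * (Q₁ + S₀) * (L₁ + T₀) - (L₁ + L₀) * (P₁ + Q₁ + A₀) * (Z₁ + G₀)) =
      (Z₁ + Z₀) * (Z₀ * L₀ * R₀ + Z₀ * S₀ * T₀ - L₀ * A₀ * G₀)
      + Z₀ * (L₁ * (P₁ + Q₁) * (Z₀ - G₀) + Z₁ * (L₁ * R₀ + L₀ * P₁ + Q₁ * T₀ + S₀ * L₁ - L₁ * A₀ - L₀ * (P₁ + Q₁)))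
      + (L₀ * P₁ * Z₀ ^ 2 - L₀ * G₀ * (P₁ + Q₁) * Z₀ - L₀ * (Z₀ - G₀) * A₀ * Z₁ + L₁ * Z₀ ^ 2 * (R₀ + S₀) - L₁ * Z₀ * G₀ * A₀
          + Q₁ * T₀ * Z₀ ^ 2) := by
  ring

/-- **THE OR-STEP, arithmetic form**: if the low piece's `K̃₀`, and the two mixed forms `M̃₁`, `M̃₂'` are nonnegative, then `K̃(u; U ∪ C) ≥ 0`
(the degenerate case `Z₀ = 0` — null low piece — uses the trivial atom bounds). [this work] -/
theorem orStep_arith {Z₁ L₁ P₁ Q₁ Z₀ L₀ G₀ T₀ A₀ S₀ R₀ : ℝ}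
    (hZ₀ : 0 ≤ Z₀) (hL₀ : 0 ≤ L₀) (hL₀Z : L₀ ≤ Z₀) (hG₀ : 0 ≤ G₀) (hG₀Z : G₀ ≤ Z₀) (hT₀ : 0 ≤ T₀) (hT₀G : T₀ ≤ G₀)
    (hA₀ : 0 ≤ A₀) (hA₀Z : A₀ ≤ Z₀) (hS₀ : 0 ≤ S₀) (hS₀A : S₀ ≤ A₀) (hR₀ : 0 ≤ R₀) (hR₀A : R₀ ≤ A₀)
    (hK₀ : 0 ≤ Z₀ * L₀ * R₀ + Z₀ * S₀ * T₀ - L₀ * A₀ * G₀)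
    (hM₁ : 0 ≤ L₁ * (P₁ + Q₁) * (Z₀ - G₀) + Z₁ * (L₁ * R₀ + L₀ * P₁ + Q₁ * T₀ + S₀ * L₁ - L₁ * A₀ - L₀ * (P₁ + Q₁)))
    (hM₂ : 0 ≤ L₀ * P₁ * Z₀ ^ 2 - L₀ * G₀ * (P₁ + Q₁) * Z₀ - L₀ * (Z₀ - G₀) * A₀ * Z₁ + L₁ * Z₀ ^ 2 * (R₀ + S₀) - L₁ * Z₀ * G₀ * A₀
          + Q₁ * T₀ * Z₀ ^ 2)
    (hZ₁ : 0 ≤ Z₁) :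
    0 ≤ (Z₁ + Z₀) * (L₁ + L₀) * (P₁ + R₀) + (Z₁ + Z₀) * (Q₁ + S₀) * (L₁ + T₀) - (L₁ + L₀) * (P₁ + Q₁ + A₀) * (Z₁ + G₀) := by
  rcases hZ₀.lt_or_eq with hpos | hzero
  · have key := orStep_identity Z₁ L₁ P₁ Q₁ Z₀ L₀ G₀ T₀ A₀ S₀ R₀
    have hrhs : 0 ≤ (Z₁ + Z₀) * (Z₀ * L₀ * R₀ + Z₀ * S₀ * T₀ - L₀ * A₀ * G₀)
        + Z₀ * (L₁ * (P₁ + Q₁) * (Z₀ - G₀) + Z₁ * (L₁ * R₀ + L₀ * P₁ + Q₁ * T₀ + S₀ * L₁ - L₁ * A₀ - L₀ * (P₁ + Q₁)))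
        + (L₀ * P₁ * Z₀ ^ 2 - L₀ * G₀ * (P₁ + Q₁) * Z₀ - L₀ * (Z₀ - G₀) * A₀ * Z₁ + L₁ * Z₀ ^ 2 * (R₀ + S₀) - L₁ * Z₀ * G₀ * A₀
            + Q₁ * T₀ * Z₀ ^ 2) :=
      add_nonneg (add_nonneg (mul_nonneg (add_nonneg hZ₁ hZ₀) hK₀) (mul_nonneg hZ₀ hM₁)) hM₂
    rw [← key] at hrhs
    exact nonneg_of_mul_nonneg_right hrhs hpos
  · -- `Z₀ = 0`: all low atoms vanish and the form is identically `0`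
    have h1 : L₀ = 0 := le_antisymm (hzero ▸ hL₀Z) hL₀
    have h2 : G₀ = 0 := le_antisymm (hzero ▸ hG₀Z) hG₀
    have h3 : T₀ = 0 := le_antisymm (h2 ▸ hT₀G) hT₀
    have h4 : A₀ = 0 := le_antisymm (hzero ▸ hA₀Z) hA₀
    have h5 : S₀ = 0 := le_antisymm (h4 ▸ hS₀A) hS₀
    have h6 : R₀ = 0 := le_antisymm (h4 ▸ hR₀A) hR₀
    rw [← hzero, h1, h2, h3, h4, h5, h6]; ring_nf; exact le_rfl

/-! ## The weighted Chebyshev sum inequality (oppositely monotone functions are negatively correlated) -/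

/-- **Weighted Chebyshev sum inequality**: for weights `p ≥ 0` on a finite set of naturals, `f` non-increasing and `g` non-decreasing,
`(Σ p)·(Σ p f g) ≤ (Σ p f)·(Σ p g)`. [folklore] -/
theorem weighted_chebyshev_antivary (s : Finset ℕ) (p f g : ℕ → ℝ) (hp : ∀ k ∈ s, 0 ≤ p k)
    (hf : ∀ j ∈ s, ∀ k ∈ s, j ≤ k → f k ≤ f j) (hg : ∀ j ∈ s, ∀ k ∈ s, j ≤ k → g j ≤ g k) :
    (∑ k ∈ s, p k) * (∑ k ∈ s, p k * (f k * g k)) ≤ (∑ k ∈ s, p k * f k) * (∑ k ∈ s, p k * g k) := by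
  -- symmetrised double sum: `2·(RHS − LHS) = Σ_{j,k} p_j p_k (f_j − f_k)(g_k − g_j) ≥ 0`
  have hterm : ∀ j ∈ s, ∀ k ∈ s, 0 ≤ p j * p k * ((f j - f k) * (g k - g j)) := by
    intro j hj k hk
    refine mul_nonneg (mul_nonneg (hp j hj) (hp k hk)) ?_
    rcases le_total j k with hjk | hkj
    · exact mul_nonneg (sub_nonneg.2 (hf j hj k hk hjk)) (sub_nonneg.2 (hg j hj k hk hjk))
    · exact mul_nonneg_of_nonpos_of_nonpos (sub_nonpos.2 (hf k hk j hj hkj)) (sub_nonpos.2 (hg k hk j hj hkj))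
  have hsum : 0 ≤ ∑ j ∈ s, ∑ k ∈ s, p j * p k * ((f j - f k) * (g k - g j)) :=
    sum_nonneg fun j hj => sum_nonneg fun k hk => hterm j hj k hk
  have e : ∑ j ∈ s, ∑ k ∈ s, p j * p k * ((f j - f k) * (g k - g j)) =
      2 * ((∑ k ∈ s, p k * f k) * (∑ k ∈ s, p k * g k) - (∑ k ∈ s, p k) * (∑ k ∈ s, p k * (f k * g k))) := by
    have h1 : ∑ j ∈ s, ∑ k ∈ s, p j * p k * ((f j - f k) * (g k - g j)) =
        ∑ j ∈ s, ∑ k ∈ s, (p j * f j * (p k * g k) + p k * f k * (p j * g j)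
          - p j * (p k * (f k * g k)) - p k * (p j * (f j * g j))) :=
      sum_congr rfl fun j _ => sum_congr rfl fun k _ => by ring
    rw [h1]
    simp only [sum_sub_distrib, sum_add_distrib, ← mul_sum, ← sum_mul]
    ring
  rw [e] at hsum
  linarith


/-! ## The two mixed forms, abstract fibre versions (memo §5.3–5.5) -/

/-- **From the class hypothesis at the shifted slot and ball monotonicity to the fibre inequality `(T_y)`** (memo (5.3)):
`z·m·U + z·k·W' ≤ m·a·Wc` (the complement form of `(2′)(A_y, C)` at slot `t−x`, fibre `y`, in mixed atoms) and `q·m ≤ k·l`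
(ball monotonicity) give `z·l·U + z·q·W' ≤ l·a·Wc`. [this work] -/
theorem orStep_T_of_S1 {z l a q k m U W' Wc : ℝ} (hz : 0 ≤ z) (hl : 0 ≤ l) (hlm : l ≤ m) (hql : q ≤ l) (hq : 0 ≤ q) (hW' : 0 ≤ W')
    (hS1 : z * m * U + z * k * W' ≤ m * a * Wc) (hBM : q * m ≤ k * l) :
    z * l * U + z * q * W' ≤ l * a * Wc := by
  have hm : 0 ≤ m := hl.trans hlm
  have key : m * (z * l * U + z * q * W') ≤ m * (l * a * Wc) := by
    have h1 : z * m * l * U + z * k * l * W' ≤ m * l * a * Wc := by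
      have := mul_le_mul_of_nonneg_right hS1 hl
      nlinarith [this]
    have h2 : z * q * m * W' ≤ z * k * l * W' := by
      have := mul_le_mul_of_nonneg_left hBM (mul_nonneg hz hW')
      nlinarith [this]
    nlinarith [h1, h2]
  rcases hm.lt_or_eq with hpos | hzero
  · exact le_of_mul_le_mul_left key hpos
  · have hl0 : l = 0 := le_antisymm (hzero ▸ hlm) hl
    have hq0 : q = 0 := le_antisymm (hl0 ▸ hql) hq
    rw [hl0, hq0]; simp

/-- **`M̃₁ ≥ 0` for one low fibre `x`, abstract form** (memo (5.4)).  Data per high fibre `y ∈ s`: masses `z, l, a, q, k, m`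
(`z = w`, `l = w(L)`, `a = u`, `q = u(L)`, `k = u(L_x)`, `m = w(L_x)` on the fibre, `m = ℓx·z` for the common ratio `ℓx`); constants
`Wc, U, W'` (low-fibre masses of `Cᶜ`, `Cᶜ∩H` under `u`, `Cᶜ∩L`).  From `(S1')` per fibre, ball monotonicity, the monotonicity of
`l/z` (non-increasing) and `k/z` (non-decreasing) along the chain — via the weighted Chebyshev inequality —
`(Σz)(Σl)·U + (Σz)(Σq)·W' ≤ (Σl)(Σa)·Wc`. [this work] -/
theorem orStep_M1_fibre (s : Finset ℕ) (z l a q k m : ℕ → ℝ) {ℓx Wc U W' : ℝ} (hℓx : 0 ≤ ℓx) (hW' : 0 ≤ W')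
    (hz : ∀ y ∈ s, 0 ≤ z y) (hl : ∀ y ∈ s, 0 ≤ l y) (hq : ∀ y ∈ s, 0 ≤ q y) (hk : ∀ y ∈ s, 0 ≤ k y)
    (haz : ∀ y ∈ s, a y ≤ z y) (hka : ∀ y ∈ s, k y ≤ a y) (hql : ∀ y ∈ s, q y ≤ l y) (hlm : ∀ y ∈ s, l y ≤ m y)
    (hm : ∀ y ∈ s, m y = ℓx * z y)
    (hS1 : ∀ y ∈ s, z y * m y * U + z y * k y * W' ≤ m y * a y * Wc)
    (hBM : ∀ y ∈ s, q y * m y ≤ k y * l y)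
    (hMonZ : ∀ y ∈ s, ∀ y' ∈ s, y ≤ y' → l y' * z y ≤ l y * z y')
    (hMonK : ∀ y ∈ s, ∀ y' ∈ s, y ≤ y' → k y * z y' ≤ k y' * z y) :
    (∑ y ∈ s, z y) * (∑ y ∈ s, l y) * U + (∑ y ∈ s, z y) * (∑ y ∈ s, q y) * W' ≤ (∑ y ∈ s, l y) * (∑ y ∈ s, a y) * Wc := by
  have ha : ∀ y ∈ s, 0 ≤ a y := fun y hy => (hk y hy).trans (hka y hy)
  have hZ : 0 ≤ ∑ y ∈ s, z y := sum_nonneg hz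
  have hL : 0 ≤ ∑ y ∈ s, l y := sum_nonneg hl
  rcases hℓx.lt_or_eq with hpos | hzero
  swap
  · -- `ℓx = 0`: every `m`, hence every `l` and `q`, vanishes
    have hl0 : ∀ y ∈ s, l y = 0 := fun y hy =>
      le_antisymm ((hlm y hy).trans (by rw [hm y hy, ← hzero, zero_mul])) (hl y hy)
    have hq0 : ∀ y ∈ s, q y = 0 := fun y hy => le_antisymm ((hql y hy).trans (hl0 y hy).le) (hq y hy)
    rw [sum_eq_zero hl0, sum_eq_zero hq0]; simp
  -- (I) summed `(S1')/z`:  `ℓx (Σz) U + (Σk) W' ≤ ℓx (Σa) Wc`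
  have hI : ∀ y ∈ s, ℓx * z y * U + k y * W' ≤ ℓx * a y * Wc := by
    intro y hy
    rcases (hz y hy).lt_or_eq with hzp | hz0
    · have h := hS1 y hy
      rw [hm y hy] at h
      have h' : z y * (ℓx * z y * U + k y * W') ≤ z y * (ℓx * a y * Wc) := by nlinarith [h]
      exact le_of_mul_le_mul_left h' hzp
    · have ha0 : a y = 0 := le_antisymm (hz0 ▸ haz y hy) (ha y hy)
      have hk0 : k y = 0 := le_antisymm (ha0 ▸ hka y hy) (hk y hy)
      rw [← hz0, ha0, hk0]; simp
  have hIsum : ℓx * (∑ y ∈ s, z y) * U + (∑ y ∈ s, k y) * W' ≤ ℓx * (∑ y ∈ s, a y) * Wc := by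
    have := sum_le_sum hI
    have e1 : ∑ y ∈ s, (ℓx * z y * U + k y * W') = ℓx * (∑ y ∈ s, z y) * U + (∑ y ∈ s, k y) * W' := by
      rw [sum_add_distrib, ← sum_mul, ← sum_mul, ← mul_sum]
    have e2 : ∑ y ∈ s, ℓx * a y * Wc = ℓx * (∑ y ∈ s, a y) * Wc := by rw [← sum_mul, ← mul_sum]
    rw [e1, e2] at this
    exact this
  -- (II) Chebyshev on the support of `z`
  set s' := s.filter (fun y => 0 < z y) with hs'
  have hs'sub : s' ⊆ s := filter_subset _ _
  have hzs' : ∀ y ∈ s', 0 < z y := fun y hy => (mem_filter.1 hy).2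
  have hoff : ∀ y ∈ s, y ∉ s' → z y = 0 := fun y hy hy' => by
    by_contra h; exact hy' (mem_filter.2 ⟨hy, lt_of_le_of_ne (hz y hy) (Ne.symm h)⟩)
  have hloff : ∀ y ∈ s, y ∉ s' → l y = 0 := fun y hy hy' =>
    le_antisymm ((hlm y hy).trans (by rw [hm y hy, hoff y hy hy', mul_zero])) (hl y hy)
  have hkoff : ∀ y ∈ s, y ∉ s' → k y = 0 := fun y hy hy' => by
    have ha0 : a y = 0 := le_antisymm ((haz y hy).trans (hoff y hy hy').le) (ha y hy)
    exact le_antisymm (ha0 ▸ hka y hy) (hk y hy)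
  have cheb := weighted_chebyshev_antivary s' z (fun y => l y / z y) (fun y => k y / z y)
    (fun y hy => (hzs' y hy).le)
    (fun j hj k' hk' hjk => by
      rw [div_le_div_iff₀ (hzs' k' hk') (hzs' j hj)]
      exact hMonZ j (hs'sub hj) k' (hs'sub hk') hjk)
    (fun j hj k' hk' hjk => by
      rw [div_le_div_iff₀ (hzs' j hj) (hzs' k' hk')]
      exact hMonK j (hs'sub hj) k' (hs'sub hk') hjk)
  have e1 : ∑ y ∈ s', z y * (l y / z y) = ∑ y ∈ s, l y := by
    rw [← sum_subset hs'sub (fun y hy hy' => hloff y hy hy')]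
    exact sum_congr rfl fun y hy => mul_div_cancel₀ _ (hzs' y hy).ne'
  have e2 : ∑ y ∈ s', z y * (k y / z y) = ∑ y ∈ s, k y := by
    rw [← sum_subset hs'sub (fun y hy hy' => hkoff y hy hy')]
    exact sum_congr rfl fun y hy => mul_div_cancel₀ _ (hzs' y hy).ne'
  have e3 : ∑ y ∈ s', z y = ∑ y ∈ s, z y := sum_subset hs'sub (fun y hy hy' => hoff y hy hy')
  have e4 : ∑ y ∈ s', z y * (l y / z y * (k y / z y)) = ∑ y ∈ s, l y * k y / z y := by
    rw [← sum_subset hs'sub (fun y hy hy' => by rw [hloff y hy hy']; simp)]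
    exact sum_congr rfl fun y hy => by field_simp
  rw [e1, e2, e3, e4] at cheb
  -- (III) ball monotonicity: `ℓx q ≤ l k / z` termwise
  have hIII : ∀ y ∈ s, ℓx * q y ≤ l y * k y / z y := by
    intro y hy
    rcases (hz y hy).lt_or_eq with hzp | hz0
    · rw [le_div_iff₀ hzp]
      have := hBM y hy; rw [hm y hy] at this; nlinarith [this]
    · have hl0 : l y = 0 := le_antisymm ((hlm y hy).trans (by rw [hm y hy, ← hz0, mul_zero])) (hl y hy)
      have hq0 : q y = 0 := le_antisymm ((hql y hy).trans hl0.le) (hq y hy)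
      rw [hq0, hl0]; simp
  have hIIIsum : ℓx * ∑ y ∈ s, q y ≤ ∑ y ∈ s, l y * k y / z y := by
    rw [mul_sum]; exact sum_le_sum hIII
  -- combine: `ℓx · LHS ≤ ℓx · RHS`
  have hK : 0 ≤ ∑ y ∈ s, k y := sum_nonneg hk
  have main : ℓx * ((∑ y ∈ s, z y) * (∑ y ∈ s, l y) * U + (∑ y ∈ s, z y) * (∑ y ∈ s, q y) * W') ≤
      ℓx * ((∑ y ∈ s, l y) * (∑ y ∈ s, a y) * Wc) := by
    have step1 : (∑ y ∈ s, z y) * (ℓx * ∑ y ∈ s, q y) * W' ≤ (∑ y ∈ s, l y) * (∑ y ∈ s, k y) * W' :=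
      mul_le_mul_of_nonneg_right ((mul_le_mul_of_nonneg_left hIIIsum hZ).trans cheb) hW'
    have step2 : (∑ y ∈ s, l y) * (ℓx * (∑ y ∈ s, z y) * U + (∑ y ∈ s, k y) * W') ≤
        (∑ y ∈ s, l y) * (ℓx * (∑ y ∈ s, a y) * Wc) := mul_le_mul_of_nonneg_left hIsum hL
    nlinarith [step1, step2]
  exact le_of_mul_le_mul_left main hpos

/-- **`M̃₂' ≥ 0` for one high fibre `y`, abstract form** (memo (5.5)).  Fibre-`y` masses `z, l, a, q`; low-piece totals
`Z₀, G₀, L₀, T₀, A₀` and `Uc = u(low ∩ Cᶜ ∩ H)`.  From the summed fibre inequality `(T̄_y)`, `λ_y ≤ ℓ₀` and `α_y ≥ a₀`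
(cross-multiplied), the summand `n_y` of `M̃₂'` is nonnegative. [this work] -/
theorem orStep_M2_fibre {z l a q Z₀ G₀ L₀ T₀ A₀ Uc : ℝ} (hz : 0 ≤ z) (hl : 0 ≤ l) (hlz : l ≤ z) (haz : a ≤ z) (ha : 0 ≤ a)
    (hql : q ≤ l) (hq : 0 ≤ q) (hG₀Z : G₀ ≤ Z₀)
    (hT : z * l * Uc + z * q * (L₀ - T₀) ≤ l * a * (Z₀ - G₀))
    (hMonL : Z₀ * l ≤ L₀ * z) (hMonA : A₀ * z ≤ Z₀ * a) :
    0 ≤ Z₀ * (Z₀ - G₀) * L₀ * a - (Z₀ - G₀) * A₀ * (L₀ * z - Z₀ * l) - Z₀ ^ 2 * Uc * l - Z₀ ^ 2 * (L₀ - T₀) * q := by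
  have key : z * (Z₀ * (Z₀ - G₀) * L₀ * a - (Z₀ - G₀) * A₀ * (L₀ * z - Z₀ * l) - Z₀ ^ 2 * Uc * l - Z₀ ^ 2 * (L₀ - T₀) * q) =
      Z₀ ^ 2 * (l * a * (Z₀ - G₀) - z * l * Uc - z * q * (L₀ - T₀)) + (Z₀ - G₀) * (L₀ * z - Z₀ * l) * (Z₀ * a - A₀ * z) := by
    ring
  have hrhs : 0 ≤ Z₀ ^ 2 * (l * a * (Z₀ - G₀) - z * l * Uc - z * q * (L₀ - T₀))
      + (Z₀ - G₀) * (L₀ * z - Z₀ * l) * (Z₀ * a - A₀ * z) :=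
    add_nonneg (mul_nonneg (sq_nonneg _) (by linarith))
      (mul_nonneg (mul_nonneg (sub_nonneg.2 hG₀Z) (sub_nonneg.2 hMonL)) (sub_nonneg.2 hMonA))
  rcases hz.lt_or_eq with hpos | hzero
  · rw [← key] at hrhs; exact nonneg_of_mul_nonneg_right hrhs hpos
  · have hl0 : l = 0 := le_antisymm (hzero ▸ hlz) hl
    have ha0 : a = 0 := le_antisymm (hzero ▸ haz) ha
    have hq0 : q = 0 := le_antisymm (hl0 ▸ hql) hq
    rw [hl0, ha0, hq0, ← hzero]; ring_nf; exact le_rfl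

/-! ## Fibres along one coordinate -/

/-- **Fibre decomposition**: a grid sum is the sum over the values `k` of coordinate `i` of the fibre sums. [folklore] -/
theorem fibre_sum_decomp (i : κ) (f : (κ → Fin (N + 1)) → ℝ) :
    ∑ v, f v = ∑ k : Fin (N + 1), ∑ v, if v i = k then f v else 0 := by
  rw [← sum_fiberwise univ (fun v : κ → Fin (N + 1) => v i) f]
  exact sum_congr rfl fun k _ => by rw [sum_filter]

/-- Transport between two fibres of coordinate `i`: `Σ_{v_i = k} g(v with v_i := k') = Σ_{v_i = k'} g(v)`. [folklore] -/
theorem fibre_sum_transport (i : κ) (g : (κ → Fin (N + 1)) → ℝ) (k k' : Fin (N + 1)) :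
    (∑ v, if v i = k then g (update v i k') else 0) = ∑ v, if v i = k' then g v else 0 := by
  rw [← sum_filter, ← sum_filter]
  refine sum_nbij' (fun v => update v i k') (fun v => update v i k) ?_ ?_ ?_ ?_ ?_
  · intro v _; simp only [mem_filter, mem_univ, true_and, update_self]
  · intro v _; simp only [mem_filter, mem_univ, true_and, update_self]
  · intro v hv
    simp only [mem_filter, mem_univ, true_and] at hv
    rw [update_idem, ← hv, update_eq_self]
  · intro v hv
    simp only [mem_filter, mem_univ, true_and] at hv
    rw [update_idem, ← hv, update_eq_self]
  · intro v _; rfl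

/-- **Cross-fibre identity** for a product weight and an `i`-invariant factor `g`:
`φ_i(k')·Σ_{v_i = k} Φ(v) g(v) = φ_i(k)·Σ_{v_i = k'} Φ(v) g(v)`. [folklore] -/
theorem fibre_cross_eq (φ : κ → ℕ → ℝ) (i : κ) (g : (κ → Fin (N + 1)) → ℝ) (hg : ∀ v k, g (update v i k) = g v)
    (k k' : Fin (N + 1)) :
    φ i k' * (∑ v, if v i = k then piWeight N φ v * g v else 0) =
      φ i k * (∑ v, if v i = k' then piWeight N φ v * g v else 0) := by
  rw [← fibre_sum_transport i (fun v => piWeight N φ v * g v) k k', mul_sum, mul_sum]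
  refine sum_congr rfl fun v _ => ?_
  by_cases hv : v i = k
  · rw [if_pos hv, if_pos hv, hg, piWeight_update, piWeight_eq_mul_erase φ i v, hv]; ring
  · rw [if_neg hv, if_neg hv, mul_zero, mul_zero]

/-- **Cross-fibre inequality** for a numerator with the one-coordinate cross inequalities and an `i`-invariant factor `g ≥ 0`:
`φ_i(k')·Σ_{v_i = k} u(v) g(v) ≤ φ_i(k)·Σ_{v_i = k'} u(v) g(v)` for `k ≤ k'`. [this work] -/
theorem fibre_cross_le (φ : κ → ℕ → ℝ) (i : κ) {u : (κ → Fin (N + 1)) → ℝ}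
    (hmono : ∀ v j (x x' : Fin (N + 1)), x ≤ x' → u (update v j x) * φ j x' ≤ u (update v j x') * φ j x)
    (g : (κ → Fin (N + 1)) → ℝ) (hg : ∀ v k, g (update v i k) = g v) (hg0 : ∀ v, 0 ≤ g v) {k k' : Fin (N + 1)} (hkk' : k ≤ k') :
    φ i k' * (∑ v, if v i = k then u v * g v else 0) ≤ φ i k * (∑ v, if v i = k' then u v * g v else 0) := by
  rw [← fibre_sum_transport i (fun v => u v * g v) k k', mul_sum, mul_sum]
  refine sum_le_sum fun v _ => ?_
  by_cases hv : v i = k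
  · rw [if_pos hv, if_pos hv, hg]
    have h := hmono v i k k' hkk'
    rw [show update v i k = v from by rw [← hv, update_eq_self]] at h
    calc φ i k' * (u v * g v) = (u v * φ i k') * g v := by ring
      _ ≤ (u (update v i k') * φ i k) * g v := mul_le_mul_of_nonneg_right h (hg0 v)
      _ = φ i k * (u (update v i k') * g v) := by ring
  · rw [if_neg hv, if_neg hv, mul_zero, mul_zero]

end ProfileGrid

end SahiOneStep

end Summit.CriticalPhenomena.PercolationContinuityZ3.Theorems
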